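import Summits.ValiantsHypothesis.ValiantsHypothesis.Theorems.MonotoneRestorationOrbitRestorationQPSymmetricModelMoments
import HarnessLib

/-!
# Route MonotoneRestoration — crux `OrbitRestorationQP` (stmt-ValiantsHypothesis-18293), line `depth_three_rung`:
# the symmetric-model sub-rung of `A_∞` — COMMON-OFFSET FRAMES RESTORE from the invariance of `e_d(Y)` ALONE

Helper file (`--supports stmt-ValiantsHypothesis-18293`), def-free.  Namespace
`Summit.ValiantsHypothesis.ValiantsHypothesis.Theorems.OrbitRestorationQPDepthThreeRung.SymmetricModel` (continued from
`…SymmetricModel.lean`, `…SymmetricModelMoments.lean`).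

The symmetric-model rung asks: `a · e_d(Y)` matrix-symmetric (`Y` an affine frame of `≤ n^c + c` forms) ⇒ qp-orbit-restorable.
`…SymmetricModelMoments.lean` proves it for TRUNCATED-STABLE frames (all of `e_1(Y), …, e_d(Y)` invariant).  Here the
hypothesis is brought down to the rung's own — invariance of the SINGLE coefficient `e_d(Y)` — for every frame with a
COMMON NON-ZERO OFFSET, `Y = (ℓ_{w_i} + β)_{i<m}` (Ben-Or's own interpolation frames `(t + L_i)_i` are of this kind):

* `esymm_map_add_eq_sum` — TRANSLATION FORMULA: `e_d(S + r) = Σ_j e_j(S) · r^{d-j} · C(|S|-j, d-j)` (as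
  `Σ_{j ≤ |S|} e_j(S) · r^{(|S|-j)-(|S|-d)} · C(|S|-j, |S|-d)`), for any multiset `S` of polynomials and any polynomial `r`
  (Vieta + `(Π (X + y)) ∘ (X + r)` + `Polynomial.coeff_X_add_C_pow`);
* `isHomogeneous_esymm_lin` — `e_j` of a LINEAR frame is homogeneous of degree `j`;
* `homogeneousComponent_esymm_translate` — the degree-`j` component of `e_d(Λ + β)` is `β^{d-j} C(m-j, d-j) · e_j(Λ)`;
* `esymm_lin_symmetric_of_translate_symmetric` — for `β ≠ 0` and `j ≤ d ≤ m`: if `e_d(Λ + β)` is matrix-symmetric then so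
  is `e_j(Λ)` (homogeneous components of invariants are invariant, `DerivativeTower.mact_homogeneousComponent`);
* ★ `qpOrbitRestorable_esymm_translate` — **COMMON-OFFSET FRAMES RESTORE**: for every `c` there is `c'` such that for all
  `n`, every linear frame `Λ = (ℓ_{w_i})_{i<m}` with `m ≤ n^c + c`, every `β ≠ 0`, `a`, `d`: if `e_d(Λ + β)` is matrix-symmetric
  then `a · e_d(Λ + β)` is `QPOrbitRestorable c' n` (the linear frame `Λ` is truncated-stable to order `d`, so
  `qpOrbitRestorable_esymm_of_invariantTruncation` restores every `e_j(Λ)`, and `e_d(Λ + β) ∈ ℂ[e_0(Λ), …, e_d(Λ)]`);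
* `symmetricModel_translate` — family form: the symmetric-model rung HOLDS on all common-offset frames with `β ≠ 0`.

So the rung's residue shrinks to frames WITHOUT a common non-zero offset: homogeneous linear frames (`β = 0`, where only
the top coefficient is constrained) and frames with at least two distinct offsets.  Honest label: a sub-rung theorem; no
registered stub is closed; A_∞, the crux and VP ≠ VNP are NOT moved.

## References
* A. Shpilka, *Affine projections of symmetric polynomials*, J. Comput. System Sci. 65 (2002) 639–659, Thm 3.1. [Shpilka2002]
* A. Dawar, G. Wilsenach, *Symmetric arithmetic circuits*, ToC 21 (2025), §3.3 (ORB). [DawarWilsenach2025]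
-/

noncomputable section

open scoped Classical

-- `Summit.ValiantsHypothesis.ValiantsHypothesis.…` is the tree's single-conjunct layout (Sub = Summit).
set_option linter.dupNamespace false

namespace Summit.ValiantsHypothesis.ValiantsHypothesis.Theorems

namespace OrbitRestorationQPDepthThreeRung

namespace SymmetricModel

open MvPolynomial Finset Equiv WaringJennrich LevelStructure ProductAction

variable {n : ℕ}

/-! ### The translation formula for elementary symmetric polynomials -/

/-- **TRANSLATION FORMULA.**  For a multiset `S` of polynomials, a polynomial `r` and `d ≤ |S|`:
`e_d(S + r) = Σ_{j ≤ |S|} e_j(S) · r^{(|S|-j)-(|S|-d)} · C(|S|-j, |S|-d)` (the terms with `j > d` vanish).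
(Vieta for `S + r`, `Π_y (X + (y + r)) = (Π_y (X + y)) ∘ (X + r)`, and the binomial coefficients of `(X + r)^{|S|-j}`.)
[folklore] -/
theorem esymm_map_add_eq_sum (S : Multiset (MvPolynomial (Fin n × Fin n) ℂ)) (r : MvPolynomial (Fin n × Fin n) ℂ)
    {d : ℕ} (hd : d ≤ Multiset.card S) :
    (S.map fun y => y + r).esymm d =
      ∑ j ∈ range (Multiset.card S + 1), S.esymm j *
        (r ^ (Multiset.card S - j - (Multiset.card S - d)) *
          ((Multiset.card S - j).choose (Multiset.card S - d) : MvPolynomial (Fin n × Fin n) ℂ)) := by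
  have hV := Multiset.prod_X_add_C_coeff (S.map fun y => y + r) (k := Multiset.card S - d)
    (by rw [Multiset.card_map]; omega)
  rw [Multiset.card_map, Nat.sub_sub_self hd, Multiset.map_map] at hV
  rw [← hV]
  have hcomp : (S.map ((fun y : MvPolynomial (Fin n × Fin n) ℂ => Polynomial.X + Polynomial.C y) ∘ fun y => y + r)).prod =
      ((S.map fun y : MvPolynomial (Fin n × Fin n) ℂ => Polynomial.X + Polynomial.C y).prod).comp
        (Polynomial.X + Polynomial.C r) := by
    rw [Polynomial.multiset_prod_comp, Multiset.map_map]
    congr 1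
    refine Multiset.map_congr rfl fun y _ => ?_
    simp only [Function.comp_apply, Polynomial.add_comp, Polynomial.X_comp, Polynomial.C_comp, map_add]
    ring
  rw [hcomp, Multiset.prod_X_add_C_eq_sum_esymm, Polynomial.comp, Polynomial.eval₂_finsetSum,
    Polynomial.finsetSum_coeff]
  refine Finset.sum_congr rfl fun j _ => ?_
  rw [Polynomial.eval₂_mul, Polynomial.eval₂_C, Polynomial.eval₂_X_pow, Polynomial.coeff_C_mul,
    Polynomial.coeff_X_add_C_pow]

/-! ### Linear frames: homogeneity and the graded pieces of a translate -/

/-- A linear form `ℓ_w` is homogeneous of degree `1`. [folklore] -/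
theorem isHomogeneous_lin (w : (Fin n × Fin n) → ℂ) : (lin w).IsHomogeneous 1 := by
  unfold lin
  exact IsHomogeneous.sum _ _ _ fun x _ => (isHomogeneous_X ℂ x).C_mul _

/-- `e_j` of a LINEAR frame is homogeneous of degree `j`. [folklore] -/
theorem isHomogeneous_esymm_lin {m : ℕ} (w : Fin m → (Fin n × Fin n) → ℂ) (j : ℕ) :
    (((univ : Finset (Fin m)).val.map fun i => lin (w i)).esymm j).IsHomogeneous j := by
  rw [Finset.esymm_map_val]
  refine IsHomogeneous.sum _ _ _ fun t ht => ?_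
  have hcard : t.card = j := (Finset.mem_powersetCard.mp ht).2
  have h := IsHomogeneous.prod t (fun i => lin (w i)) (fun _ => 1) fun i _ => isHomogeneous_lin (w i)
  rwa [Finset.sum_const, smul_eq_mul, mul_one, hcard] at h

/-- **The graded pieces of a translate.**  For a linear frame `Λ = (ℓ_{w_i})_{i<m}`, `β ∈ ℂ` and `j`, `d ≤ m`, the degree-`j`
homogeneous component of `e_d(Λ + β)` is `β^{(m-j)-(m-d)} C(m-j, m-d) · e_j(Λ)` (for `j ≤ m`; the binomial vanishes for
`j > d`). [folklore] -/
theorem homogeneousComponent_esymm_translate {m : ℕ} (w : Fin m → (Fin n × Fin n) → ℂ) (β : ℂ) {d : ℕ}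
    (hd : d ≤ m) {j : ℕ} (hj : j ≤ m) :
    homogeneousComponent j ((((univ : Finset (Fin m)).val.map fun i => lin (w i) + C β).esymm d)) =
      C (β ^ (m - j - (m - d)) * ((m - j).choose (m - d) : ℂ)) *
        ((univ : Finset (Fin m)).val.map fun i => lin (w i)).esymm j := by
  set Λ : Multiset (MvPolynomial (Fin n × Fin n) ℂ) := (univ : Finset (Fin m)).val.map fun i => lin (w i) with hΛ
  have hcard : Multiset.card Λ = m := by
    rw [hΛ, Multiset.card_map, Finset.card_val, Finset.card_univ, Fintype.card_fin]
  have hmap : ((univ : Finset (Fin m)).val.map fun i => lin (w i) + C β) = Λ.map fun y => y + C β := by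
    rw [hΛ, Multiset.map_map]
    rfl
  rw [hmap, esymm_map_add_eq_sum Λ (C β) (by rw [hcard]; exact hd), hcard, map_sum]
  have hterm : ∀ k ∈ range (m + 1), homogeneousComponent j (Λ.esymm k *
      (C β ^ (m - k - (m - d)) * ((m - k).choose (m - d) : MvPolynomial (Fin n × Fin n) ℂ))) =
      if j = k then C (β ^ (m - j - (m - d)) * ((m - j).choose (m - d) : ℂ)) * Λ.esymm j else 0 := by
    intro k _
    have hC : (C β ^ (m - k - (m - d)) * ((m - k).choose (m - d) : MvPolynomial (Fin n × Fin n) ℂ)) =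
        C (β ^ (m - k - (m - d)) * ((m - k).choose (m - d) : ℂ)) := by
      rw [map_mul, map_pow, map_natCast]
    rw [hC, mul_comm, homogeneousComponent_C_mul,
      homogeneousComponent_of_mem ((mem_homogeneousSubmodule _ _).2 (isHomogeneous_esymm_lin w k))]
    by_cases hjk : j = k
    · subst hjk
      rw [if_pos rfl, if_pos rfl]
    · rw [if_neg hjk, if_neg hjk, mul_zero]
  rw [Finset.sum_congr rfl hterm, Finset.sum_ite_eq]
  simp only [Finset.mem_range]
  rw [if_pos (by omega)]

/-- **Invariance of one coefficient of a common-offset frame forces invariance of the graded pieces.**  For a linear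
frame `Λ = (ℓ_{w_i})_{i<m}`, `β ≠ 0` and `j ≤ d ≤ m`: if `e_d(Λ + β)` is matrix-symmetric, so is `e_j(Λ)`. [folklore] -/
theorem esymm_lin_symmetric_of_translate_symmetric {m : ℕ} (w : Fin m → (Fin n × Fin n) → ℂ) {β : ℂ} (hβ : β ≠ 0)
    {d : ℕ} (hd : d ≤ m) {j : ℕ} (hj : j ≤ d)
    (hsym : ∀ σ τ : Perm (Fin n), rename (fun q : Fin n × Fin n => (σ q.1, τ q.2))
      ((((univ : Finset (Fin m)).val.map fun i => lin (w i) + C β).esymm d)) =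
        ((univ : Finset (Fin m)).val.map fun i => lin (w i) + C β).esymm d)
    (σ τ : Perm (Fin n)) :
    rename (fun q : Fin n × Fin n => (σ q.1, τ q.2)) (((univ : Finset (Fin m)).val.map fun i => lin (w i)).esymm j) =
      ((univ : Finset (Fin m)).val.map fun i => lin (w i)).esymm j := by
  set f := ((univ : Finset (Fin m)).val.map fun i => lin (w i) + C β).esymm d with hf
  have hc : (β ^ (m - j - (m - d)) * ((m - j).choose (m - d) : ℂ)) ≠ 0 := by
    refine mul_ne_zero (pow_ne_zero _ hβ) ?_
    exact_mod_cast (Nat.choose_pos (by omega)).ne'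
  have hcomp := homogeneousComponent_esymm_translate w β hd (hj.trans hd)
  -- the `j`-th homogeneous component of `f` is invariant
  have hinv : mact σ τ (homogeneousComponent j f) = homogeneousComponent j f := by
    rw [DerivativeTower.mact_homogeneousComponent, mact_apply, hsym σ τ]
  rw [hf, hcomp, map_mul, mact_apply, rename_C] at hinv
  rw [← mact_apply]
  exact mul_left_cancel₀ ((map_ne_zero_iff C (C_injective _ _)).2 hc) hinv

/-! ### Common-offset frames restore -/

/-- `e_d(Λ + β)` lies in the subalgebra generated by `e_0(Λ), …, e_d(Λ)` (translation formula; the terms with `j > d`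
vanish). [folklore] -/
theorem esymm_translate_mem_adjoin {m : ℕ} (w : Fin m → (Fin n × Fin n) → ℂ) (β : ℂ) {d : ℕ} (hd : d ≤ m) :
    (((univ : Finset (Fin m)).val.map fun i => lin (w i) + C β).esymm d) ∈
      Algebra.adjoin ℂ (Set.range fun j : Fin (d + 1) =>
        ((univ : Finset (Fin m)).val.map fun i => lin (w i)).esymm (j : ℕ)) := by
  set Λ : Multiset (MvPolynomial (Fin n × Fin n) ℂ) := (univ : Finset (Fin m)).val.map fun i => lin (w i) with hΛ
  have hcard : Multiset.card Λ = m := by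
    rw [hΛ, Multiset.card_map, Finset.card_val, Finset.card_univ, Fintype.card_fin]
  have hmap : ((univ : Finset (Fin m)).val.map fun i => lin (w i) + C β) = Λ.map fun y => y + C β := by
    rw [hΛ, Multiset.map_map]
    rfl
  rw [hmap, esymm_map_add_eq_sum Λ (C β) (by rw [hcard]; exact hd), hcard]
  refine Subalgebra.sum_mem _ fun k hk => ?_
  rw [Finset.mem_range] at hk
  by_cases hkd : k ≤ d
  · refine Subalgebra.mul_mem _ (Algebra.subset_adjoin ⟨⟨k, by omega⟩, rfl⟩) ?_
    refine Subalgebra.mul_mem _ (Subalgebra.pow_mem _ (Subalgebra.algebraMap_mem _ _) _) (natCast_mem _ _)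
  · have h0 : ((m - k).choose (m - d) : MvPolynomial (Fin n × Fin n) ℂ) = 0 := by
      rw [Nat.choose_eq_zero_of_lt (by omega), Nat.cast_zero]
    rw [h0, mul_zero, mul_zero]
    exact Subalgebra.zero_mem _

/-- ★ **COMMON-OFFSET FRAMES RESTORE FROM THE INVARIANCE OF `e_d` ALONE (unconditionally, uniform constant).**  For every
`c` there is `c'` such that at every level `n`, for every linear frame `Λ = (ℓ_{w_i})_{i<m}` with `m ≤ n^c + c`, every offset
`β ≠ 0`, every scalar `a` and every `d`: if `e_d(Λ + β)` is matrix-symmetric then `a · e_d(Λ + β)` is `QPOrbitRestorable c' n`.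
(For `d ≤ m` the graded pieces force `e_1(Λ), …, e_d(Λ)` to be invariant, so the linear frame is truncated-stable and each
`e_j(Λ)` restores by `qpOrbitRestorable_esymm_of_invariantTruncation`; `e_d(Λ + β) ∈ ℂ[e_0(Λ), …, e_d(Λ)]` restores at flat
cost; for `d > m` the polynomial is `0`.) [folklore; cite: Shpilka2002, Thm 3.1] -/
theorem qpOrbitRestorable_esymm_translate (c : ℕ) : ∃ c' : ℕ, ∀ (n m : ℕ) (w : Fin m → (Fin n × Fin n) → ℂ)
    (β : ℂ) (a : ℂ) (d : ℕ), m ≤ n ^ c + c → β ≠ 0 →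
    (∀ σ τ : Perm (Fin n), rename (fun q : Fin n × Fin n => (σ q.1, τ q.2))
      ((((univ : Finset (Fin m)).val.map fun i => lin (w i) + C β).esymm d)) =
        ((univ : Finset (Fin m)).val.map fun i => lin (w i) + C β).esymm d) →
    QPOrbitRestorable c' n (C a * (((univ : Finset (Fin m)).val.map fun i => lin (w i) + C β).esymm d)) := by
  obtain ⟨c₁, hc₁⟩ := qpOrbitRestorable_esymm_of_invariantTruncation c
  refine ⟨c₁ + 3, fun n m w β a d hm hβ hsym => ?_⟩
  by_cases hd : d ≤ m
  · -- every `e_j(Λ)`, `j ≤ d`, restores with constant `c₁`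
    have hT : ∀ t ∈ Set.range (fun j : Fin (d + 1) =>
        ((univ : Finset (Fin m)).val.map fun i => lin (w i)).esymm (j : ℕ)), QPOrbitRestorable c₁ n t := by
      rintro t ⟨j, rfl⟩
      have h := hc₁ n m w (fun _ => 0) 1 (j : ℕ) hm
      simp only [map_zero, add_zero, map_one, one_mul] at h
      refine h fun k hk1 hkj σ τ => ?_
      exact esymm_lin_symmetric_of_translate_symmetric w hβ hd (by have := j.isLt; omega) hsym σ τ
    have hmem : C a * (((univ : Finset (Fin m)).val.map fun i => lin (w i) + C β).esymm d) ∈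
        Algebra.adjoin ℂ (Set.range fun j : Fin (d + 1) =>
          ((univ : Finset (Fin m)).val.map fun i => lin (w i)).esymm (j : ℕ)) :=
      Subalgebra.mul_mem _ (Subalgebra.algebraMap_mem _ _) (esymm_translate_mem_adjoin w β hd)
    exact RowColumnRestorable.qpOrbitRestorable_of_mem_adjoin hT hmem
  · have h0 : (((univ : Finset (Fin m)).val.map fun i => lin (w i) + C β).esymm d) = 0 := by
      rw [Multiset.esymm, Multiset.powersetCard_eq_empty d
        (by rw [Multiset.card_map, Finset.card_val, Finset.card_univ, Fintype.card_fin]; omega)]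
      simp
    rw [h0, mul_zero]
    have h := RowColumnRestorable.qpOrbitRestorable_of_mem_adjoin (c := c₁) (n := n)
      (T := (∅ : Set (MvPolynomial (Fin n × Fin n) ℂ))) (fun t ht => absurd ht (Set.notMem_empty t))
      (p := 0) (Subalgebra.zero_mem _)
    exact h

/-- **THE SYMMETRIC-MODEL RUNG HOLDS ON COMMON-OFFSET FRAMES (family form).**  Every family given at every level as
`a · e_d(Λ + β)` — a linear frame of `≤ n^c + c` forms translated by a common offset `β ≠ 0` — with `e_d(Λ + β)`
matrix-symmetric is quasi-polynomially orbit-restorable.  The rung's hypothesis, verbatim, suffices on this class.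
[folklore; cite: Shpilka2002, Thm 3.1] -/
theorem symmetricModel_translate :
    ∀ f : (n : ℕ) → MvPolynomial (Fin n × Fin n) ℂ, IsMatrixSymmetric f →
      (∃ c : ℕ, ∀ n : ℕ, ∃ (m : ℕ) (w : Fin m → (Fin n × Fin n) → ℂ) (β a : ℂ) (d : ℕ),
        m ≤ n ^ c + c ∧ β ≠ 0 ∧
        f n = C a * (((univ : Finset (Fin m)).val.map fun i => lin (w i) + C β).esymm d)) →
      ∃ c : ℕ, ∀ n : ℕ, QPOrbitRestorable c n (f n) := by
  intro f hsym hf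
  obtain ⟨c, hc⟩ := hf
  obtain ⟨c', hc'⟩ := qpOrbitRestorable_esymm_translate c
  -- the scalar `a` may vanish; `0` is restorable with the same constant via `a = 0`
  refine ⟨c', fun n => ?_⟩
  obtain ⟨m, w, β, a, d, hm, hβ, hfn⟩ := hc n
  rw [hfn]
  by_cases ha : a = 0
  · have h := hc' n 0 (fun i => i.elim0) 1 0 (d + 1) (by omega) one_ne_zero (fun σ τ => by simp [Multiset.esymm])
    have h1 : (((univ : Finset (Fin 0)).val.map fun i : Fin 0 => lin (Fin.elim0 i : (Fin n × Fin n) → ℂ) + C (1 : ℂ)).esymm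
        (d + 1)) = 0 := by simp [Multiset.esymm]
    rw [h1, mul_zero] at h
    rwa [ha, map_zero, zero_mul]
  · refine hc' n m w β a d hm hβ fun σ τ => ?_
    have hs := hsym n σ τ
    rw [hfn, map_mul, rename_C] at hs
    exact mul_left_cancel₀ ((map_ne_zero_iff C (C_injective _ _)).2 ha) hs

end SymmetricModel

end OrbitRestorationQPDepthThreeRung

end Summit.ValiantsHypothesis.ValiantsHypothesis.Theorems

end
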